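import Mathlib
import HarnessLib

/-!
# Route `PoloidalWindowDoor`, crux `PoloidalWindowRigidity` (K2, stmt-NavierStokesRegularity-19708), skeleton `lrc-jet` v5,
# stub `stub_untwisted` — brick F4-tr-b: SCALAR LINEAR ODE UNIQUENESS ALONG A SEGMENT AND MULTIPLICATIVE SEPARATION OF VARIABLES

Cell ns-regularity-ideate, K2 lead ns-poloidal-K2-p1 (gen 6; `--supports stmt-NavierStokesRegularity-19708`, helper; BRIEF-v5-bricks-v2 (S4)).  Pure one-variable
real analysis (Grönwall), used twice in the translation of Branch 2b of UNTWISTED-NOTE §3 to the hypotheses of `…UntwistedStuartBranch.stuartBranch_false`: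
«`∂_z log|Q_u|` is `t`-independent ⇒ `Q_u(t,z) = θ(t)d(z)`» and «`∂_z(c/d) = 0` ⇒ `c = d(z)m(t)`».

* `eq_zero_of_hasDerivAt_mul_self` — if `h′ = a·h` on the closed segment between `z₀` and `z` (with `a` continuous there) and `h z₀ = 0`, then `h z = 0`
  (Grönwall in both orientations).
* `mul_eq_mul_of_same_linearODE` — two solutions `f, g` of the same scalar linear ODE `y′ = a·y` on a segment are proportional:
  `f z · g z₀ = f z₀ · g z`.

WHAT THIS IS NOT: not a claim about Navier–Stokes — calculus bookkeeping (bears_on LADDER-NS N0 via crux K2 = stmt-19708).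
-/

noncomputable section

-- the summit and its single sub-problem share the name (CONVENTIONS §1), as in every Theorems file
set_option linter.dupNamespace false

namespace Summit.NavierStokesRegularity.NavierStokesRegularity.Theorems.PoloidalWindowDoorPoloidalWindowRigidityLinearODEUniqueness

open Set Function Filter Topology Metric

/-- **Scalar linear ODE uniqueness on a segment (Grönwall).**  If `h′(ζ) = a(ζ)·h(ζ)` for every `ζ` in the closed segment `uIcc z₀ z`, with `a`
continuous on that segment, and `h z₀ = 0`, then `h z = 0`. [folklore] -/
theorem eq_zero_of_hasDerivAt_mul_self {h a : ℝ → ℝ} {z₀ z : ℝ}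
    (hderiv : ∀ ζ ∈ uIcc z₀ z, HasDerivAt h (a ζ * h ζ) ζ) (ha : ContinuousOn a (uIcc z₀ z)) (h0 : h z₀ = 0) :
    h z = 0 := by
  obtain ⟨K, hK⟩ := (isCompact_uIcc (a := z₀) (b := z)).exists_bound_of_continuousOn ha
  have hcont : ContinuousOn h (uIcc z₀ z) := fun ζ hζ => (hderiv ζ hζ).continuousAt.continuousWithinAt
  have hbound : ∀ ζ ∈ uIcc z₀ z, ‖a ζ * h ζ‖ ≤ K * ‖h ζ‖ + 0 := by
    intro ζ hζ
    rw [norm_mul, add_zero]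
    exact mul_le_mul_of_nonneg_right (hK ζ hζ) (norm_nonneg _)
  rcases le_total z₀ z with hle | hle
  · have hI : uIcc z₀ z = Icc z₀ z := uIcc_of_le hle
    have hg := norm_le_gronwallBound_of_norm_deriv_right_le (f := h) (f' := fun ζ => a ζ * h ζ) (δ := 0) (K := K) (ε := 0)
      (a := z₀) (b := z) (by rw [← hI]; exact hcont)
      (fun x hx => (hderiv x (by rw [hI]; exact Ico_subset_Icc_self hx)).hasDerivWithinAt)
      (by rw [h0, norm_zero]) (fun x hx => hbound x (by rw [hI]; exact Ico_subset_Icc_self hx)) z (right_mem_Icc.mpr hle)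
    rw [gronwallBound_ε0_δ0] at hg
    exact norm_le_zero_iff.mp hg
  · have hI : uIcc z₀ z = Icc z z₀ := uIcc_of_ge hle
    set γ : ℝ → ℝ := fun τ => h (-τ) with hγ
    have hγderiv : ∀ τ ∈ Icc (-z₀) (-z), HasDerivAt γ (-(a (-τ) * h (-τ))) τ := by
      intro τ hτ
      have hmem : -τ ∈ uIcc z₀ z := by
        rw [hI]; exact ⟨by linarith [hτ.2], by linarith [hτ.1]⟩
      have h1 := (hderiv (-τ) hmem).scomp τ (hasDerivAt_neg τ)
      have h1' : HasDerivAt (fun τ' => h (-τ')) ((-1 : ℝ) • (a (-τ) * h (-τ))) τ := h1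
      simpa using h1'
    have hγcont : ContinuousOn γ (Icc (-z₀) (-z)) := fun τ hτ => (hγderiv τ hτ).continuousAt.continuousWithinAt
    have hg := norm_le_gronwallBound_of_norm_deriv_right_le (f := γ) (f' := fun τ => -(a (-τ) * h (-τ))) (δ := 0) (K := K) (ε := 0)
      (a := -z₀) (b := -z) hγcont (fun x hx => (hγderiv x (Ico_subset_Icc_self hx)).hasDerivWithinAt)
      (by simp [hγ, h0]) (fun x hx => by
        have hmem : -x ∈ uIcc z₀ z := by
          rw [hI]; exact ⟨by linarith [hx.2], by linarith [hx.1]⟩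
        rw [norm_neg]
        simpa [hγ] using hbound (-x) hmem) (-z) (right_mem_Icc.mpr (by linarith))
    rw [gronwallBound_ε0_δ0] at hg
    have : γ (-z) = 0 := norm_le_zero_iff.mp hg
    simpa [hγ] using this

/-- **Two solutions of the same scalar linear ODE are proportional.**  If `f′ = a·f` and `g′ = a·g` on the segment `uIcc z₀ z` (`a` continuous
there), then `f z · g z₀ = f z₀ · g z`.  (Apply the uniqueness lemma to `h := f·g(z₀) − f(z₀)·g`.)  This is the multiplicative SEPARATION OF VARIABLES used
in Branch 2b: a two-variable quantity whose vertical logarithmic derivative does not depend on the horizontal variable factorises as `θ(t)·d(z)`. [folklore] -/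
theorem mul_eq_mul_of_same_linearODE {f g a : ℝ → ℝ} {z₀ z : ℝ}
    (hf : ∀ ζ ∈ uIcc z₀ z, HasDerivAt f (a ζ * f ζ) ζ) (hg : ∀ ζ ∈ uIcc z₀ z, HasDerivAt g (a ζ * g ζ) ζ)
    (ha : ContinuousOn a (uIcc z₀ z)) : f z * g z₀ = f z₀ * g z := by
  set h : ℝ → ℝ := fun ζ => f ζ * g z₀ - f z₀ * g ζ with hh
  have hderiv : ∀ ζ ∈ uIcc z₀ z, HasDerivAt h (a ζ * h ζ) ζ := by
    intro ζ hζ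
    have h1 := ((hf ζ hζ).mul_const (g z₀)).sub ((hg ζ hζ).const_mul (f z₀))
    refine h1.congr_deriv ?_
    simp only [hh]
    ring
  have h0 : h z₀ = 0 := by simp only [hh]; ring
  have := eq_zero_of_hasDerivAt_mul_self hderiv ha h0
  simp only [hh] at this
  linarith

end Summit.NavierStokesRegularity.NavierStokesRegularity.Theorems.PoloidalWindowDoorPoloidalWindowRigidityLinearODEUniqueness

end
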